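import Summits.QuantumFields.BalabanUV.T4Continuum.Support.VariationalSmoothedPlanting

/-!
# T⁴ programme, spine node NE2 (U1a), lane P2 — SUPPLIER s5a (ONE⁰-pos), file 2: THE BLOCK MEANS OF THE SMOOTHED PLANTING —
# first order cancels by the digit reflection, the defect `f − Q(A P f)` is one half of an average of SECOND differences of `f`

NE2 formalisation swarm `b2b-balaban-t4-ne2-formalise-*`, leaf 04 GEN 2, supplier item «P2-SUPPLIER s5a = ONE⁰-pos» (journal INTENT
CLAIMS.log l.8445), file 2 of 3; file 1 = `VariationalSmoothedPlanting` (the competitor `A(P f) = smooth (plant f)` and its energy).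

THE COMPUTATION ([folklore] lattice bookkeeping; coarse torus `Tor N`, fine torus `Tor (fine L N)`, every `L ≥ 1`).
 * §1 CARRIES: adding a vector of naturals `q` to a block point `L·y + i` lands in the block `y + ⌊(i + q)/L⌋` with digits `(i + q) mod L`
   (`bpt_add_natVec`, coordinatewise in `ZMod`); the smoothing translate `ιj − ιj_max + ιj′` of file 1 moved to nonnegative form:
   `L·y + i + ιj − ιj_max + ιj′ = L·(y − 𝟙) + i + (1 + j + j′)` (`translate_eq`), hence
   `blockOf(L·y + i + ιj − ιj_max + ιj′) = y − 𝟙 + ⌊(i + 1 + j + j′)/L⌋` (`blockOf_translate`; the quotient is a digit in `{0,1,2}`, `carryDigit`).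
 * §2 THE MEANS: `(Q(A P f))(y) = E_ω f(y − 𝟙 + a(ω))`, `ω = (i, j, j′)` uniform on `([0,L)^d)³`, `a = carryDigit` (`QsOp_smooth_plant`).
 * §3 THE REFLECTION `ω ↦ ω^rev` (every digit `t ↦ L−1−t`) is an involution of the index set with `a(ω^rev) = 2 − a(ω)` (`carryDigit_rev3`:
   `⌊(3L−2−s)/L⌋ = 2 − ⌊(s+1)/L⌋` for `s ≤ 3L−3`), so `E_ω f(y − 𝟙 + a(ω)) = E_ω f(y + 𝟙 − a(ω))` (`mean_reflect`) and therefore, with the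
   CUBE VECTOR `c(ω) := a(ω) − 𝟙 ∈ {−1,0,1}^d`,
     `f(y) − (Q(A P f))(y) = −½·E_ω [f(y + c(ω)) − 2f(y) + f(y − c(ω))]`                          (`defect_eq`)
   — the FIRST-ORDER part of the block-mean defect CANCELS (the position-space face of King's «Δ^{(1)} = Δ + O(Δ²)»); and by Jensen
     **`nsq (f − Q(A P f)) ≤ ¼·ρ_cube f`**,  `ρ_cube f := Σ_{e ∈ {0,1,2}^d} nsq (f(· + (e−𝟙)) − 2f + f(· − (e−𝟙)))`       (`nsq_defect_le`)
   — second differences of `f` along the `3^d` vectors of the unit cube (the diagonal ones are controlled by the lattice Hessian; bounding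
   them is the business of leaf REG⁺, which serves «any second-difference functional», CLAIMS.log l.≈8160).
File 3 (`VariationalOneStepInterpolant`) restores the block means exactly with the in-block trial function and assembles `hONE` at `U = 1`.

HONEST FRAMING (T4-DAG p. 1).  `U = 1`; [folklore] lattice analysis on the cell's carriers; statements and constants OURS; nothing
printed is a hypothesis; no `def … : Prop`; no `sorry`; axioms standard.  A SUPPLIER engine for ONE⁺ — NOT ONE⁺ with background, NOT
NE2⁺; NE2 NOT proved; spine 0/9; rung (B)+1 finite T⁴ — NOT infinite volume, NOT mass gap, NOT Clay.  HONEST DEPENDENCY (cell, verbatim):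
continuum YM on T⁴ ⇐ BetaPertH ∧ nine spine estimates (0/9 proved); BetaPertH ⇐ (D1) ∧ (D4) ∧ CAP+tail; G-an2-4 gates asym, D1 and NE2/3/4.
-/

noncomputable section

open scoped BigOperators Matrix
open Finset

namespace Summit.QuantumFields.BalabanUV.T4Continuum.VariationalSmoothedMeans

open Literature.MathematicalPhysics.QuantumFieldTheory.Balaban1983to89.B5Prop11Plancherel (Tor fine unitVec)
open Literature.MathematicalPhysics.QuantumFieldTheory.Balaban1983to89.B5Prop11Lower (nsq nsq_nonneg)
open Literature.MathematicalPhysics.QuantumFieldTheory.Balaban1983to89.B5Block118 (tstep up up_add upHom_intCast iota bpt QsOp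
  QsOp_mulVec)
open Literature.MathematicalPhysics.QuantumFieldTheory.Balaban1983to89.B5Blocks16 (blockOf blockOf_bpt)
open Summit.QuantumFields.BalabanUV.T4Continuum.ScalarBlockPoincare (nsq_sum_le nsq_smul transS boxAvg)
open Summit.QuantumFields.BalabanUV.T4Continuum.VariationalSmoothedPlanting (plant plant_bpt jmax boxAvgNeg smooth card_offsets)

variable {d : ℕ} (L : ℕ) [NeZero L] (N : Fin d → ℕ) [hN : ∀ μ, NeZero (N μ)]

/-! ## §1 Carries -/

omit [NeZero L] hN in
/-- `up` is additive: differences. [folklore] -/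
theorem up_sub (y y' : Tor N) : up L N (y - y') = up L N y - up L N y' := by
  funext ν
  simp [up]

omit [NeZero L] hN in
/-- `up 𝟙 = L·𝟙`: one coarse unit in every direction is `L` fine units. [folklore] -/
theorem up_one : up L N (fun _ => (1 : ZMod _)) = fun ν => (L : ZMod (fine L N ν)) := by
  funext ν
  have h := upHom_intCast L N ν (1 : ℤ)
  simp only [up]
  push_cast at h ⊢
  simpa using h

omit hN in
/-- **CARRIES**: `L·y + i + q = L·(y + ⌊(i+q)/L⌋) + ((i+q) mod L)` for every vector of naturals `q`, coordinatewise. [folklore] -/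
theorem bpt_add_natVec (y : Tor N) (i : Fin d → Fin L) (q : Fin d → ℕ) :
    bpt L N y i + (fun ν => ((q ν : ℕ) : ZMod (fine L N ν)))
      = bpt L N (y + fun ν => ((((i ν : ℕ) + q ν) / L : ℕ) : ZMod (N ν)))
          (fun ν => ⟨((i ν : ℕ) + q ν) % L, Nat.mod_lt _ (Nat.pos_of_ne_zero (NeZero.ne L))⟩) := by
  have hup : up L N (fun ν => ((((i ν : ℕ) + q ν) / L : ℕ) : ZMod (N ν)))
      = fun ν => ((L * (((i ν : ℕ) + q ν) / L) : ℕ) : ZMod (fine L N ν)) := by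
    funext ν
    have h := upHom_intCast L N ν ((((i ν : ℕ) + q ν) / L : ℕ) : ℤ)
    rw [Int.cast_natCast, Int.cast_natCast] at h
    simp only [up]
    rw [Nat.cast_mul]
    exact h
  funext ν
  simp only [bpt, up_add, hup, Pi.add_apply, iota]
  have key : ((i ν : ℕ) : ZMod (fine L N ν)) + ((q ν : ℕ) : ZMod (fine L N ν))
      = ((L * (((i ν : ℕ) + q ν) / L) : ℕ) : ZMod (fine L N ν)) + ((((i ν : ℕ) + q ν) % L : ℕ) : ZMod (fine L N ν)) := by
    rw [← Nat.cast_add, ← Nat.cast_add, Nat.div_add_mod]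
  rw [add_assoc, key]
  ring

omit hN in
/-- the coordinates of the maximal offset: `(ι j_max)_ν = L − 1`. [folklore] -/
theorem iota_jmax (ν : Fin d) : iota L N (jmax L) ν = (L : ZMod (fine L N ν)) - 1 := by
  have hL : 1 ≤ L := Nat.pos_of_ne_zero (NeZero.ne L)
  simp only [iota, jmax]
  rw [Nat.cast_sub hL, Nat.cast_one]

omit hN in
/-- **THE SMOOTHING TRANSLATE IN NONNEGATIVE FORM**: `L·y + i + ιj − ιj_max + ιj′ = L·(y − 𝟙) + i + (1 + j + j′)`. [folklore] -/
theorem translate_eq (y : Tor N) (i j j' : Fin d → Fin L) :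
    bpt L N y i + iota L N j + -iota L N (jmax L) + iota L N j'
      = bpt L N (y - fun _ => 1) i + fun ν => ((1 + (j ν : ℕ) + (j' ν : ℕ) : ℕ) : ZMod (fine L N ν)) := by
  funext ν
  simp only [bpt, Pi.add_apply, Pi.neg_apply, up_sub, Pi.sub_apply, iota_jmax]
  rw [up_one]
  simp only [iota]
  push_cast
  ring

/-- the index set of the triple average: `ω = (i, j, j′) ∈ ([0,L)^d)³`. [folklore] -/
abbrev Idx (d L : ℕ) : Type := (Fin d → Fin L) × (Fin d → Fin L) × (Fin d → Fin L)

omit [NeZero L] hN in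
/-- the digit sum `i + 1 + j + j′` is `< 3L`. [folklore] -/
theorem digitSum_lt (ω : Idx d L) (ν : Fin d) : (ω.1 ν : ℕ) + 1 + (ω.2.1 ν : ℕ) + (ω.2.2 ν : ℕ) < 3 * L := by
  have h1 := (ω.1 ν).is_lt; have h2 := (ω.2.1 ν).is_lt; have h3 := (ω.2.2 ν).is_lt
  omega

omit hN in
/-- the CARRY DIGIT `a(ω)_ν = ⌊(i_ν + 1 + j_ν + j′_ν)/L⌋ ∈ {0,1,2}`. [folklore] -/
def carryDigit (ω : Idx d L) (ν : Fin d) : Fin 3 :=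
  ⟨((ω.1 ν : ℕ) + 1 + (ω.2.1 ν : ℕ) + (ω.2.2 ν : ℕ)) / L,
    (Nat.div_lt_iff_lt_mul (Nat.pos_of_ne_zero (NeZero.ne L))).mpr (digitSum_lt L ω ν)⟩

/-- the CUBE VECTOR of a digit function `e ∈ {0,1,2}^d`: `(e − 𝟙)_ν ∈ {−1,0,1}` in `ZMod (N ν)`. [folklore] -/
def cubeVec (e : Fin d → Fin 3) : Tor N := fun ν => ((e ν : ℕ) : ZMod (N ν)) - 1

/-- **THE BLOCK OF THE SMOOTHING TRANSLATE**: `blockOf(L·y + i + ιj − ιj_max + ιj′) = y − 𝟙 + a(i,j,j′) = y + cubeVec (a(i,j,j′))`. [folklore] -/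
theorem blockOf_translate (y : Tor N) (i j j' : Fin d → Fin L) :
    blockOf L N (bpt L N y i + iota L N j + -iota L N (jmax L) + iota L N j') = y + cubeVec N (carryDigit L (i, j, j')) := by
  rw [translate_eq, bpt_add_natVec, blockOf_bpt]
  funext ν
  simp only [Pi.add_apply, Pi.sub_apply, cubeVec, carryDigit]
  have e : (i ν : ℕ) + (1 + (j ν : ℕ) + (j' ν : ℕ)) = (i ν : ℕ) + 1 + (j ν : ℕ) + (j' ν : ℕ) := by ring
  rw [e]
  ring

/-! ## §2 The block means of the smoothed planting -/

omit [NeZero L] hN in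
/-- the cardinality of the index set: `|([0,L)^d)³| = (L^d)³`. [folklore] -/
theorem card_Idx : (Fintype.card (Idx d L) : ℂ) = ((L : ℂ) ^ d) ^ 3 := by
  simp only [Idx, Fintype.card_prod]
  push_cast
  rw [card_offsets]
  ring

omit hN in
/-- the smoothing at a point, as a double sum. [folklore] -/
theorem smooth_apply (g : Tor (fine L N) → ℂ) (x : Tor (fine L N)) :
    smooth L N g x = ((L : ℂ) ^ d)⁻¹ * ∑ j : Fin d → Fin L, ((L : ℂ) ^ d)⁻¹ *
      ∑ j' : Fin d → Fin L, g (x + iota L N j + -iota L N (jmax L) + iota L N j') := by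
  simp only [smooth, boxAvgNeg, boxAvg, transS, Pi.smul_apply, Finset.sum_apply, smul_eq_mul]

/-- **THE BLOCK MEANS OF THE SMOOTHED PLANTING**: `(Q(A P f))(y) = |Ω|⁻¹·Σ_{ω=(i,j,j′)} f(y + c(ω))`. [folklore] -/
theorem QsOp_smooth_plant (f : Tor N → ℂ) (y : Tor N) :
    (QsOp L N *ᵥ smooth L N (plant L N f)) y
      = ((Fintype.card (Idx d L) : ℂ))⁻¹ * ∑ ω : Idx d L, f (y + cubeVec N (carryDigit L ω)) := by
  have hL : ((L : ℂ) ^ d) ≠ 0 := pow_ne_zero _ (by exact_mod_cast NeZero.ne L)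
  rw [QsOp_mulVec, card_Idx]
  simp only [smooth_apply, plant, blockOf_translate]
  rw [Fintype.sum_prod_type]
  simp only [Fintype.sum_prod_type, Finset.mul_sum]
  refine Finset.sum_congr rfl fun i _ => Finset.sum_congr rfl fun j _ => Finset.sum_congr rfl fun j' _ => ?_
  field_simp

/-! ## §3 The digit reflection and the cancellation of the first order -/

omit [NeZero L] in
/-- reflecting every digit of an offset: `t ↦ L − 1 − t`. [folklore] -/
def revAll (i : Fin d → Fin L) : Fin d → Fin L := fun ν => Fin.rev (i ν)

omit [NeZero L] in
/-- the digit reflection is an involution. [folklore] -/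
theorem revAll_revAll (i : Fin d → Fin L) : revAll L (revAll L i) = i := by
  funext ν; simp [revAll]

omit [NeZero L] in
/-- reflecting every digit of `i, j, j′`: an involution of the index set. [folklore] -/
def rev3 : Idx d L ≃ Idx d L where
  toFun ω := (revAll L ω.1, revAll L ω.2.1, revAll L ω.2.2)
  invFun ω := (revAll L ω.1, revAll L ω.2.1, revAll L ω.2.2)
  left_inv ω := by simp only [revAll_revAll]
  right_inv ω := by simp only [revAll_revAll]

omit [NeZero L] hN in
/-- the components of the reflection. [folklore] -/
theorem rev3_apply (ω : Idx d L) (ν : Fin d) :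
    ((rev3 L ω).1 ν : ℕ) = L - 1 - (ω.1 ν : ℕ) ∧ ((rev3 L ω).2.1 ν : ℕ) = L - 1 - (ω.2.1 ν : ℕ) ∧
      ((rev3 L ω).2.2 ν : ℕ) = L - 1 - (ω.2.2 ν : ℕ) := by
  simp only [rev3, Equiv.coe_fn_mk, revAll, Fin.val_rev]
  omega

omit hN in
/-- the carry arithmetic under reflection: `⌊(3L − 2 − s)/L⌋ + ⌊(s + 1)/L⌋ = 2` for `s ≤ 3L − 3`. [folklore] -/
theorem carry_rev (s : ℕ) (hs : s + 3 ≤ 3 * L) : (3 * L - 2 - s) / L + (s + 1) / L = 2 := by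
  have hL : 0 < L := Nat.pos_of_ne_zero (NeZero.ne L)
  set a := (s + 1) / L with ha
  set b := (s + 1) % L with hb
  have hab : L * a + b = s + 1 := Nat.div_add_mod (s + 1) L
  have hb' : b < L := Nat.mod_lt _ hL
  have ha2 : a ≤ 2 := by
    have : a < 3 := (Nat.div_lt_iff_lt_mul hL).mpr (by omega)
    omega
  have hP : L * a ≤ L * 2 := Nat.mul_le_mul_left L ha2
  have e1 : L * (2 - a) = L * 2 - L * a := Nat.mul_sub L 2 a
  have e : 3 * L - 2 - s = L * (2 - a) + (L - 1 - b) := by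
    rw [e1]
    generalize L * a = P at hab hP ⊢
    omega
  rw [e, Nat.mul_add_div hL, Nat.div_eq_of_lt (by omega : L - 1 - b < L), add_zero]
  omega

omit hN in
/-- **THE CARRY DIGIT IS ODD UNDER REFLECTION**: `a(ω^rev)_ν = 2 − a(ω)_ν`. [folklore] -/
theorem carryDigit_rev3 (ω : Idx d L) (ν : Fin d) : (carryDigit L (rev3 L ω) ν : ℕ) + (carryDigit L ω ν : ℕ) = 2 := by
  obtain ⟨h1, h2, h3⟩ := rev3_apply L ω ν
  have b1 := (ω.1 ν).is_lt; have b2 := (ω.2.1 ν).is_lt; have b3 := (ω.2.2 ν).is_lt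
  simp only [carryDigit, Fin.val_mk, h1, h2, h3]
  have e : L - 1 - (ω.1 ν : ℕ) + 1 + (L - 1 - (ω.2.1 ν : ℕ)) + (L - 1 - (ω.2.2 ν : ℕ))
      = 3 * L - 2 - ((ω.1 ν : ℕ) + (ω.2.1 ν : ℕ) + (ω.2.2 ν : ℕ)) := by omega
  have e' : (ω.1 ν : ℕ) + 1 + (ω.2.1 ν : ℕ) + (ω.2.2 ν : ℕ) = ((ω.1 ν : ℕ) + (ω.2.1 ν : ℕ) + (ω.2.2 ν : ℕ)) + 1 := by ring
  rw [e, e']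
  exact carry_rev L _ (by omega)

omit hN in
/-- hence the reflected cube vector is the negative: `c(ω^rev) = −c(ω)`. [folklore] -/
theorem cubeVec_rev3 (ω : Idx d L) : cubeVec N (carryDigit L (rev3 L ω)) = -cubeVec N (carryDigit L ω) := by
  funext ν
  simp only [cubeVec, Pi.neg_apply]
  have h := carryDigit_rev3 L ω ν
  have hc : ((carryDigit L (rev3 L ω) ν : ℕ) : ZMod (N ν)) = 2 - ((carryDigit L ω ν : ℕ) : ZMod (N ν)) := by
    have : ((carryDigit L (rev3 L ω) ν : ℕ) : ZMod (N ν)) + ((carryDigit L ω ν : ℕ) : ZMod (N ν)) = 2 := by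
      rw [← Nat.cast_add, h]; norm_num
    exact eq_sub_of_add_eq this
  rw [hc]
  ring

omit hN in
/-- **REFLECTION OF THE MEAN**: `Σ_ω f(y + c(ω)) = Σ_ω f(y − c(ω))`. [folklore] -/
theorem mean_reflect (f : Tor N → ℂ) (y : Tor N) :
    ∑ ω : Idx d L, f (y + cubeVec N (carryDigit L ω)) = ∑ ω : Idx d L, f (y - cubeVec N (carryDigit L ω)) := by
  rw [← (rev3 L).sum_comp (fun ω => f (y + cubeVec N (carryDigit L ω)))]
  refine Finset.sum_congr rfl fun ω _ => ?_
  rw [cubeVec_rev3, sub_eq_add_neg]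

/-- the second difference of `f` along the vector `v`: `f(· + v) − 2f + f(· − v)`. [folklore] -/
def secondDiff (v : Tor N) (f : Tor N → ℂ) : Tor N → ℂ := fun y => f (y + v) - 2 * f y + f (y - v)

/-- the CUBE second-difference functional: `ρ_cube f = Σ_{e ∈ {0,1,2}^d} nsq (Δ_{e − 𝟙} f)`. [folklore] -/
def rhoCube (f : Tor N → ℂ) : ℝ := ∑ e : Fin d → Fin 3, nsq (secondDiff N (cubeVec N e) f)

/-- `ρ_cube ≥ 0`. [folklore] -/
theorem rhoCube_nonneg (f : Tor N → ℂ) : 0 ≤ rhoCube N f := Finset.sum_nonneg fun _ _ => nsq_nonneg _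

/-- **THE DEFECT OF THE BLOCK MEANS IS SECOND ORDER**: `f(y) − (Q(A P f))(y) = −½·|Ω|⁻¹·Σ_ω (Δ_{c(ω)} f)(y)`. [folklore] -/
theorem defect_eq (f : Tor N → ℂ) (y : Tor N) :
    f y - (QsOp L N *ᵥ smooth L N (plant L N f)) y
      = -(1 / 2) * (((Fintype.card (Idx d L) : ℂ))⁻¹ * ∑ ω : Idx d L, secondDiff N (cubeVec N (carryDigit L ω)) f y) := by
  have hK : (Fintype.card (Idx d L) : ℂ) ≠ 0 := by
    rw [card_Idx]; exact pow_ne_zero _ (pow_ne_zero _ (by exact_mod_cast NeZero.ne L))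
  have h2 : (2 : ℂ) * (QsOp L N *ᵥ smooth L N (plant L N f)) y
      = ((Fintype.card (Idx d L) : ℂ))⁻¹ *
          ∑ ω : Idx d L, (f (y + cubeVec N (carryDigit L ω)) + f (y - cubeVec N (carryDigit L ω))) := by
    rw [QsOp_smooth_plant, Finset.sum_add_distrib, ← mean_reflect]
    ring
  have hS : ∑ ω : Idx d L, (f (y + cubeVec N (carryDigit L ω)) + f (y - cubeVec N (carryDigit L ω)))
      = (Fintype.card (Idx d L) : ℂ) * (2 * (QsOp L N *ᵥ smooth L N (plant L N f)) y) := by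
    rw [h2, ← mul_assoc, mul_inv_cancel₀ hK, one_mul]
  have hsum : ∑ ω : Idx d L, secondDiff N (cubeVec N (carryDigit L ω)) f y
      = (Fintype.card (Idx d L) : ℂ) * (2 * (QsOp L N *ᵥ smooth L N (plant L N f)) y)
          - (Fintype.card (Idx d L) : ℂ) * (2 * f y) := by
    have e : ∀ ω : Idx d L, secondDiff N (cubeVec N (carryDigit L ω)) f y
        = (f (y + cubeVec N (carryDigit L ω)) + f (y - cubeVec N (carryDigit L ω))) - 2 * f y := fun ω => by
      simp only [secondDiff]; ring
    rw [Finset.sum_congr rfl fun ω _ => e ω, Finset.sum_sub_distrib, hS, Finset.sum_const, Finset.card_univ, nsmul_eq_mul]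
  rw [hsum]
  field_simp
  ring

/-- **THE BLOCK-MEAN DEFECT OF THE SMOOTHED PLANTING IS BOUNDED BY SECOND DIFFERENCES**:
`nsq (f − Q(A P f)) ≤ ¼·ρ_cube f`. [folklore] -/
theorem nsq_defect_le (f : Tor N → ℂ) :
    nsq (f - QsOp L N *ᵥ smooth L N (plant L N f)) ≤ 1 / 4 * rhoCube N f := by
  have hK0 : (0 : ℝ) < (Fintype.card (Idx d L) : ℝ) := by
    have : 0 < Fintype.card (Idx d L) := Fintype.card_pos
    exact_mod_cast this
  -- the defect as a scalar multiple of a sum of second differences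
  have e : f - QsOp L N *ᵥ smooth L N (plant L N f)
      = ((-(1 / 2) * ((Fintype.card (Idx d L) : ℂ))⁻¹ : ℂ)) •
          ∑ ω : Idx d L, secondDiff N (cubeVec N (carryDigit L ω)) f := by
    funext y
    rw [Pi.sub_apply, defect_eq, Pi.smul_apply, Finset.sum_apply, smul_eq_mul, mul_assoc]
  rw [e, nsq_smul, norm_mul, norm_neg, norm_inv, Complex.norm_natCast, norm_div, norm_one, Complex.norm_ofNat]
  have h1 := nsq_sum_le (Finset.univ : Finset (Idx d L)) (fun ω => secondDiff N (cubeVec N (carryDigit L ω)) f)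
  rw [Finset.card_univ] at h1
  -- each summand is one term of `ρ_cube`
  have h2 : ∑ ω : Idx d L, nsq (secondDiff N (cubeVec N (carryDigit L ω)) f) ≤ ∑ _ω : Idx d L, rhoCube N f := by
    refine Finset.sum_le_sum fun ω _ => ?_
    exact Finset.single_le_sum (f := fun e : Fin d → Fin 3 => nsq (secondDiff N (cubeVec N e) f))
      (fun _ _ => nsq_nonneg _) (Finset.mem_univ (carryDigit L ω))
  rw [Finset.sum_const, Finset.card_univ, nsmul_eq_mul] at h2
  have hρ := rhoCube_nonneg N f
  calc (1 / 2 * (Fintype.card (Idx d L) : ℝ)⁻¹) ^ 2 * nsq (∑ ω : Idx d L, secondDiff N (cubeVec N (carryDigit L ω)) f)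
      ≤ (1 / 2 * (Fintype.card (Idx d L) : ℝ)⁻¹) ^ 2 * ((Fintype.card (Idx d L) : ℝ) * ((Fintype.card (Idx d L) : ℝ) * rhoCube N f)) :=
        mul_le_mul_of_nonneg_left (h1.trans (mul_le_mul_of_nonneg_left h2 hK0.le)) (by positivity)
    _ = 1 / 4 * rhoCube N f := by field_simp; ring

end Summit.QuantumFields.BalabanUV.T4Continuum.VariationalSmoothedMeans

end
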